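/-
Origin: expansion seat `prover-pub-hodgecm-mc-binder-1-g17-0`, handover #4r3 2026-08-20T22:31:33Z md5 f74a69e1ffe8 (175 l.; REPLACE of HodgeCM/Model/LiuDictionaryInstance.lean — PKG file now db63d1c58e25 (179 l., incl. packager Origin header); body of record c1c2d6973e7b (175 l.) → f74a69e1ffe8; owner axioms-1 #4 (RUN 64) — CONSENT: axioms-1-g15 STATUS l.14542; token strike only: liuDictionaryOfWeil … hA V … (no h₂); NAMES for audit: HodgeCM.Model.liuDictionaryOfWeil_Ω · HodgeCM.Model.liuDictionaryOfWeil_adm) (`HOME/mc/pub-hodgecm-mc-binder-1-g17/campaign/new/LiuDictionaryInstance.lean`, md5 f74a69e1ffe8, 175 lines);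
landed by the gen-27 packager (p-g27) in gate run 65 REPLACES the earlier landed copy of `HodgeCM/Model/LiuDictionaryInstance.lean` (verbatim).
-/
/-
unit pub-hodgecm-mc-axioms-1-g15 (gen 15), seat planner-pub-hodgecm-mc-axioms-1-g15-0, 2026-08-20.
(J3) THE ADÈLIC-SIDE INSTANCE of the real-carrier dictionary, typing (T1′) of theta-3-g26's r3 DEFMATCH READ §5b:
`Ω := Weil central coinvariants` (theta-3 O5 `Model/WeilCentralCoinvariants`), `H := Tower`, `res := resTotal`
(binder-1-g16 `LiuDictionary.ofTower`), `adm := IsReflexOfTypeG` (binder-2-g17 #91).  KERNEL definitions only: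
no `def … : Prop` record, no cited sentence, nothing of E / row 9 / MODEL-N is touched.
-/
import Summits.HodgeConjecture.HodgeCM.Model.LiuDictionaryTower
import Summits.HodgeConjecture.HodgeCM.Model.WeilCentralCoinvariants_3
import Summits.HodgeConjecture.HodgeCM.Model.Binders.JLiuCornerOfReflex

/-!
# (J3) The dictionary with Weil-coinvariant carriers

[Liu21, Def. 4.10 display (4.2), App. D proof of Lemma D.1 Steps 1–3] index the constituents of `H¹_B(A_∞) ⊗ ℂ` by adèlic
oscillator triples `(μ, ε, χ)` and realise `ω(μ, ε, χ)` as the maximal quotient of the Weil representation (restricted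
through the splitting `ι_μ` to `U(V) × U(W_ε)`) on which `U(W_ε)(𝔸_f) = E¹(𝔸_f)` acts by `χ`.  On the cell side a hermitian
LINE `W` over `L` together with a COMPATIBLE PAIR SPLITTING `s : U(V)(𝔸) × U(W)(𝔸) → Mp` (the vendored
`GelbartRogawski1991.splittingDatum … |>.IsCompatible s`) plays the part of `(ε, ι_μ)`, and theta-3-g26's
`HodgeCM.WeilCoinv.weilCoinv … χ hs` is that maximal `χ`-quotient as a representation of `U(V, JV)(𝔸_f)`.  The `V`-side
Gram matrix `JV` is GENERAL and `U(V)(𝔸_f) = ↥V.adelicFin` acts through a PULLBACK HOM `ιV : ↥V.adelicFin →* U(JV)(𝔸_f)`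
(sinst-1-g9's datum seam, option (A): the honest theta forms' Weil operator is `ω_ψ ∘ s_pair` at the FRAMED diagonal datum
`JV := diagonal (frameD V)` with `ιV :=` carch's frame transport `finFrameCongr`; the naive case is `JV := V.Hm`, `ιV := id`).

This file fixes the SHAPE of the instance and nothing more:
* `HermLineDatum L` / `PairSplitting JV TV ℓ` / `SplitLine JV TV …` — the raw index: a hermitian line (`JW`, its `L₀`-form `TW`,
  `M := 1`) with a COMPATIBLE pair splitting `s` (lines only: Liu's `W_ε` is one-dimensional, `U(W_ε) = E¹`);
* `liuDictionaryOfWeil … ιV Good GoodChar PhiMu typeOf : LiuDictionary hHD hI h₁ h₃ V` —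
  `LiuDictionary.ofTower` (binder-1-g16, RUN 63) with `Char := {p : SplitLine … // Good p}`, `Adm p := {χ // GoodChar p χ}`,
  `Ω p a := Representation.asModule ((weilCoinv … a.1 p.1.hs).comp ιV)`,
  `PhiMu`, and `adm p d := d.IsReflexOfTypeG ι₁ (typeOf p)` (binder-2-g17 #91).
The CUT predicates `Good` (weight one at `∞`, admissible line — [Liu21] Def. 4.12), `GoodChar` (the admissible central
characters), `PhiMu` («`ι₁ ∈ Φ_μ`», on the admissible locus `Im ι₁(e) < 0`) and the type map `typeOf` (the (J4a) type) are
PARAMETERS: they are read off `s_∞` by the theta lane (theta-3) and must make the index ENUMERATE Liu's (r3 READ §5b K0) before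
any cited sentence (`Prop413`, `Irreducible`, `Thm418_2`, `Thm418C`) is assumed over this instance.  Nothing is cited here.
-/

noncomputable section

open Function Set
open NumberField
open Literature.AlgebraicGeometry.Motives
open Literature.AlgebraicGeometry.ShimuraVarieties
open Literature.AlgebraicGeometry.HodgeTheory
open Literature.NumberTheory.Automorphic
open Literature.NumberTheory.Automorphic.PicardCM
open Literature.NumberTheory.Transcendental (Arapura2012_Cor_15_4_6)
open Literature.NumberTheory.GelbartRogawski1991 Literature.NumberTheory.GelbartRogawski1991.UnitaryDualPair
open Literature.NumberTheory.Weil1964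
open scoped Kronecker

namespace HodgeCM.Model

open HodgeCM.Model.TowerLevel HodgeCM.Model.TowerCarrier HodgeCM.Literature.Theta

variable (hHD : exists_isReal_hodgeModel) (hI : hodgePQ_independent_of_hodgeModel)
  (h₁ : BallQuotientUniformised) (h₃ : CMAbelianVarietyRealised) (hA : Arapura2012_Cor_15_4_6)
variable {L : CMField} {ι₁ : (L : Type) →+* ℂ} (V : HermSpace3 L ι₁)

/-- **A hermitian LINE over `L`** (`W = (L, JW)`, with its `L₀`-rational form `TW`) together with the enumeration `e` of the
symplectic index set `Fin 3 × Fin 1` of `Res_{L/L₀}(V ⊗_L W)` used by the vendored Weil representation. [folklore] -/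
structure HermLineDatum (L : CMField) : Type where
  /-- size of the symplectic index set `Fin 3 × Fin 1` -/
  n : ℕ
  /-- its enumeration -/
  e : Fin 3 × Fin 1 ≃ Fin n
  /-- the hermitian line's Gram matrix over `L` -/
  JW : Matrix (Fin 1) (Fin 1) (L : Type)
  /-- its `L₀`-rational form -/
  TW : Matrix (Fin 1) (Fin 1) ↥(maximalRealSubfield (L : Type))
  hW : TW.IsSymm
  hWd : IsUnit TW.det
  hJW : JW = TW.map (algebraMap _ (L : Type))

/- The `V`-side pack: a GENERAL hermitian Gram matrix `JV` on `L³` with its `L₀`-form `TV` and the quadratic datum `δ, d`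
(the constants every theta file of record carries; the naive instance is `JV := V.Hm`). -/
variable (JV : Matrix (Fin 3) (Fin 3) (L : Type)) (TV : Matrix (Fin 3) (Fin 3) ↥(maximalRealSubfield (L : Type)))
  {δ : (L : Type)} (hcδ : IsCMField.complexConj (L : Type) δ = -δ) (hδ : δ ≠ 0) {d : ↥(maximalRealSubfield (L : Type))}
  (hd : δ * δ = algebraMap _ (L : Type) d) (hV : TV.IsSymm) (hVd : IsUnit TV.det)
  (hJV : JV = TV.map (algebraMap _ (L : Type)))

/-- The type of PAIR SPLITTINGS `U(V)(𝔸) × U(W)(𝔸) → Mp(Res(V ⊗ W))` of the line `ℓ` (into the vendored adèlic metaplectic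
group of the Gram matrix `adelicGram L₀ ℓ.e TV ℓ.TW`). [folklore] -/
def PairSplitting (ℓ : HermLineDatum L) : Type :=
  UnitaryGroup.adelicPair (↥(maximalRealSubfield (L : Type))) (L : Type) (IsCMField.complexConj (L : Type)) 3 1 JV ℓ.JW →*
    adelicMpCont (↥(maximalRealSubfield (L : Type))) (Fin ℓ.n) (adelicGram (↥(maximalRealSubfield (L : Type))) ℓ.e TV ℓ.TW)

/-- COMPATIBILITY of a pair splitting with the rational splitting of the vendored splitting datum
([GelbartRogawski1991] §3.1 Prop. 3.1.1): by DEFINITION `SplittingDatum.IsCompatible s` of the datum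
`splittingDatum L₀ L c 3 1 ℓ.e JV ℓ.JW …` — a definitional predicate (an abbreviation, not a cited sentence), kept outside the
`SplitLine` telescope because the inline form does not elaborate at default heartbeats. [folklore] -/
abbrev PairSplitting.IsCompat {ℓ : HermLineDatum L} (s : PairSplitting JV TV ℓ) : Prop :=
  (splittingDatum (↥(maximalRealSubfield (L : Type))) (L : Type) (IsCMField.complexConj (L : Type)) 3 1 ℓ.e JV ℓ.JW
    hcδ hδ hd hV ℓ.hW hVd ℓ.hWd hJV ℓ.hJW).IsCompatible s

/-- **The raw adèlic index of the cell: a hermitian LINE over `L` with a COMPATIBLE pair splitting** (the cell-side reading of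
Liu's pair `(ε, ι_μ)`). [folklore] -/
structure SplitLine : Type extends HermLineDatum L where
  /-- the pair splitting `U(V)(𝔸) × U(W)(𝔸) → Mp` -/
  s : PairSplitting JV TV toHermLineDatum
  /-- its compatibility with the rational splitting -/
  hs : s.IsCompat JV TV hcδ hδ hd hV hVd hJV

variable {V JV TV hcδ hδ hd hV hVd hJV}

namespace SplitLine

variable (p : SplitLine JV TV hcδ hδ hd hV hVd hJV)
  (ιV : ↥V.adelicFin →*
    ↥(UnitaryGroup.finAdelic (↥(maximalRealSubfield (L : Type))) (L : Type) (IsCMField.complexConj (L : Type)) 3 JV))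

/-- the characters of `U(W)(𝔸_f) = E¹(𝔸_f)` for the line of `p` -/
abbrev CharW : Type :=
  ↥(UnitaryGroup.finAdelic (↥(maximalRealSubfield (L : Type))) (L : Type) (IsCMField.complexConj (L : Type)) 1 p.JW) →* ℂˣ

/-- **`Ω(p, χ)`** — theta-3-g26's Weil central coinvariants of the line-with-splitting `p` at the character `χ` of `U(W)(𝔸_f)`,
as a `ℂ[↥V.adelicFin]`-module through the pullback hom `ιV` (`Representation.asModule` of `HodgeCM.WeilCoinv.weilCoinv ∘ ιV`).
[folklore] -/
abbrev Ω (χ : p.CharW) : Type :=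
  Representation.asModule
    ((HodgeCM.WeilCoinv.weilCoinv (↥(maximalRealSubfield (L : Type))) (L : Type) (IsCMField.complexConj (L : Type)) 3 1 p.e JV
      p.JW hcδ hδ hd hV p.hW hVd p.hWd hJV p.hJW χ p.hs).comp ιV)

/-- plumbing check: `Ω(p, χ)` carries the coherent structures `LiuDictionary.ofTower` asks of its `Ω` slot. -/
example (χ : p.CharW) : Module (adelicAlgebra V) (p.Ω ιV χ) := inferInstance

example (χ : p.CharW) : IsScalarTower ℂ (adelicAlgebra V) (p.Ω ιV χ) := inferInstance

end SplitLine

/-- plumbing check, naive case: at `JV := V.Hm` the identity is a pullback hom (`↥V.adelicFin` unfolds to `U(V.Hm)(𝔸_f)`). -/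
example : ↥V.adelicFin →*
    ↥(UnitaryGroup.finAdelic (↥(maximalRealSubfield (L : Type))) (L : Type) (IsCMField.complexConj (L : Type)) 3 V.Hm) :=
  MonoidHom.id _

variable (V) (JV) (TV) (hcδ) (hδ) (hd) (hV) (hVd) (hJV)
variable (ιV : ↥V.adelicFin →*
    ↥(UnitaryGroup.finAdelic (↥(maximalRealSubfield (L : Type))) (L : Type) (IsCMField.complexConj (L : Type)) 3 JV))

/-- **(J3) THE DICTIONARY WITH WEIL-COINVARIANT CARRIERS** (typing (T1′)): `LiuDictionary.ofTower` with
`Char := {p : SplitLine … // Good p}`, `Adm p := {χ // GoodChar p χ}`, `Ω p a := Ω(p, a)` through `ιV`, `PhiMu`,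
`adm := IsReflexOfTypeG ι₁ ∘ typeOf`.  The cut predicates and the type map are parameters (module docstring). [folklore] -/
abbrev liuDictionaryOfWeil (Good : SplitLine JV TV hcδ hδ hd hV hVd hJV → Prop)
    (GoodChar : (p : SplitLine JV TV hcδ hδ hd hV hVd hJV) → p.CharW → Prop)
    (PhiMu : SplitLine JV TV hcδ hδ hd hV hVd hJV → Prop)
    (typeOf : SplitLine JV TV hcδ hδ hd hV hVd hJV → CMType (L : Type)) : LiuDictionary hHD hI h₁ h₃ V :=
  LiuDictionary.ofTower hHD hI h₁ h₃ hA V {p : SplitLine JV TV hcδ hδ hd hV hVd hJV // Good p}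
    (fun p => {χ : p.1.CharW // GoodChar p.1 χ}) (fun p a => p.1.Ω ιV a.1) (fun p => PhiMu p.1)
    (fun p d => d.IsReflexOfTypeG ι₁ (typeOf p.1))

variable (Good : SplitLine JV TV hcδ hδ hd hV hVd hJV → Prop)
    (GoodChar : (p : SplitLine JV TV hcδ hδ hd hV hVd hJV) → p.CharW → Prop)
    (PhiMu : SplitLine JV TV hcδ hδ hd hV hVd hJV → Prop)
    (typeOf : SplitLine JV TV hcδ hδ hd hV hVd hJV → CMType (L : Type))

/-- (Ported verbatim from the HodgeCMPerL package; no docstring in the source.) -/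
theorem liuDictionaryOfWeil_H :
    (liuDictionaryOfWeil hHD hI h₁ h₃ hA V JV TV hcδ hδ hd hV hVd hJV ιV Good GoodChar PhiMu typeOf).H =
      Tower hHD hI (ballQuotientUniformisedDatum_of h₁) h₃ hA V := rfl

/-- (Ported verbatim from the HodgeCMPerL package; no docstring in the source.) -/
theorem liuDictionaryOfWeil_res (Γ : Level V) :
    (liuDictionaryOfWeil hHD hI h₁ h₃ hA V JV TV hcδ hδ hd hV hVd hJV ιV Good GoodChar PhiMu typeOf).res Γ =
      resTotal hHD hI (ballQuotientUniformisedDatum_of h₁) h₃ hA Γ := rfl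

/-- (Ported verbatim from the HodgeCMPerL package; no docstring in the source.) -/
theorem liuDictionaryOfWeil_Ω (p : {p : SplitLine JV TV hcδ hδ hd hV hVd hJV // Good p})
    (a : {χ : p.1.CharW // GoodChar p.1 χ}) :
    (liuDictionaryOfWeil hHD hI h₁ h₃ hA V JV TV hcδ hδ hd hV hVd hJV ιV Good GoodChar PhiMu typeOf).Ω p a =
      p.1.Ω ιV a.1 := rfl

/-- (Ported verbatim from the HodgeCMPerL package; no docstring in the source.) -/
theorem liuDictionaryOfWeil_adm (p : {p : SplitLine JV TV hcδ hδ hd hV hVd hJV // Good p}) (dd : LiuCMSide) :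
    (liuDictionaryOfWeil hHD hI h₁ h₃ hA V JV TV hcδ hδ hd hV hVd hJV ιV Good GoodChar PhiMu typeOf).adm p dd ↔
      dd.IsReflexOfTypeG ι₁ (typeOf p.1) := Iff.rfl

end HodgeCM.Model

end
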